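import Summits.QuantumFields.YangMills.Theorems.FluctuationComparisonRegPrIntLOrganTangentAPackageFromHeight
import Summits.QuantumFields.YangMills.Theorems.FluctuationComparisonRegPrIntLOrganTangentSecondMomentVersion
import Summits.QuantumFields.YangMills.Theorems.FluctuationComparisonRegPrIntLOrganTangentFibreMeanToolsAnyCut
import Literature.MathematicalPhysics.QuantumFieldTheory.Balaban1983to89.T3MinimiserStabilityReduction
import Literature.MathematicalPhysics.QuantumFieldTheory.Balaban1983to89.BalabanAdmissibleClassParams
import Literature.MathematicalPhysics.QuantumFieldTheory.Balaban1983to89.T4GenFunBounds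
import HarnessLib

/-!
# THE WINDOW-CONTINUOUS VERSION OF THE LOCALISED FIBRE SECOND MOMENT EXISTS FROM A HEIGHT, FOR EVERY FAMILY — R-VAR's QUANTIFIER INSTANTIATED OUTRIGHT, DEFINITION-FREE

Cell `ym3-torus` (YM ladder rung R3 = continuum `SU(2)` Yang–Mills on the three-torus — a RUNG, NOT d = 4, NOT infinite volume, NOT a mass gap, NOT Clay).  Width seat
`ym-ust-20520-w4` (gen 22), pen TQ-1 of LEAD-20520 w3 g23's `Cruxes/FluctuationComparisonRegPrIntL/LEAD-TYPING-QUEUE-w3g23.md` executed on the `Theorems/` side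
(★★OWNER g40 WORD №238: «a TQ letter … not embargoed = name it on the bus»); `--supports stmt-QuantumFields-20520 --as helper`, count-neutral, definition-free, default
heartbeats; no registry, binder or `Lines/` edit; the registered skeleton `Lines/semiclassical_s2beta.lean` v11.4 and its five stubs are untouched (0∕5, ★★OWNER RULING №36);
no claim on the crux.

WHY.  LINE g26-2 «jensen_cumulant» v1 (`Lines/jensen_cumulant.lean` 83b6f839) cuts row JEN∘ of LINE g25-1 «organ_tangent» (v2.6) as `g = q + (g − q)`, `q := ½(v − m²)`,
and pins the fibre second moment `v V := (∫ χ h² ρ′ dσ_V)∕(∫ χ ρ′ dσ_V)` POINTWISE from an ARBITRARY disintegration `σ` — LEAD typing note L-g26-2 (D25-4 corner: `σ_V` is only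
a.e.-defined).  The LEAD's repair R-VAR (TQ-1) quantifies `v` exactly as JEN∘ quantifies `m`: `∀ v, ContinuousOn v {PlaqSmall θ_j} → (a.e. on the window: integrability ∧
v V = (∫ χ h² ρ′ dσ_V)∕(∫ χ ρ′ dσ_V)) → …`.  THIS FILE shows the extra quantifier costs nothing: such a `v` EXISTS, for EVERY `F : T3Family`, from a height, in O1's frame —
the statement is ✓`…OrganTangentVersionClosed.fibreMeanVersionCan_holds` (w4 g21, p787082: row VER∘ v2.6, cutoff inlined as the R-CUT-χ token) with the integrand
`χ·(log ρ_{j+1} − log ρ′_{j+1})·ρ′_{j+1}` SQUARED to `χ·(log ρ_{j+1} − log ρ′_{j+1})²·ρ′_{j+1}` and `m` renamed `v`, NOTHING else.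
EDIT LIST (mechanical census against ✓`fibreMeanVersionCan_holds`' statement, ★★OWNER g40 WORD №240): (e1) `(Real.log (ρ (j + 1) U) - Real.log (ρ' (j + 1) U)) * ρ' (j + 1) U`
↦ `(Real.log (ρ (j + 1) U) - Real.log (ρ' (j + 1) U)) ^ 2 * ρ' (j + 1) U` at its TWO occurrences (the `Integrable` integrand and the numerator integral); (e2) `∃ (m : …)` ↦
`∃ (v : …)`, `ContinuousOn m` ↦ `ContinuousOn v`, `m V =` ↦ `v V =`.  Frame (ν-runs, `K ≤ K'`, anchor `[Ts, T]`, smooth cut below `Ts`, finite towers, membership modulo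
constants, `∀ σ` Markov disintegration clause), the window sets and the denominator `∫ χ ρ′ dσ_V` are token-for-token those of VER∘ v2.6.  These are `Theorems/`-side
statements over hypothesis-free data, NOT registry rows; the registry `Lines/semiclassical_s2beta.lean` v11.4 (RULING №36) and every `Lines/` file are untouched (J-FREEZE).

PROOF = two tree theorems composed, exactly as VER∘ closed: w5 g21's ✓(L8) `…OrganTangentAPackageFromHeight.exists_height_regularSmallFieldDisintegration` (the (A)-PACKAGE at
the window constant `24∕25` from a height, every family, unconditional) fed into LEAD w3 g23's ✓`…OrganTangentSecondMomentVersion.fibreSecondMomentVersion_of_regularSmallFieldDisintegration_ac`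
(p787883: the second-moment edition of KNITc) in BOTH cut regimes of the frame (`j < Ts`: transfer measure `mY := (ρ_{j+1}·dU_{j+1}).withDensity χ_{j+1}`; `Ts ≤ j`:
`mY := ρ_{j+1}·dU_{j+1}`), with the ramp lemmas of ✓TOOLSc `…OrganTangentFibreMeanToolsAnyCut` at `(c₁, c₂) := (1∕2, 24∕25)` and `Measurable (ρ j)` from the `∃ κ`-membership by
un-scaling — i.e. ✓`…OrganTangentRegularE2EV26.fibreMeanVersion_of_regular`'s proof (w4 g21, p784599) with the knit swapped and `hA` discharged by (L8).

WHAT IT IS NOT.  A regularity frame (disintegration uniqueness, the one-bond chart's (A)-package, window continuity) — nothing of Bałaban's renormalisation-group ANALYSIS is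
asserted or proved; VAR∘ʳ ∕ LME3∘ʳ (the R-VAR'd rows), JEN∘, LIN∘, O1 (any edition), the crux `FluctuationComparisonRegPrIntL` (stmt-QuantumFields-20520), the package's S-stubs
and `YM3TorusSU2` are NOT proved; no summit ∕ sub-problem statement is proved; rung R3 = SU(2) YM₃ on T³ — NOT d = 4, NOT infinite volume, NOT a mass gap, NOT Clay; the
Yang–Mills mass gap is NOT proved by any of this.  All credit for the mathematics: LEAD w3 g22∕g23 ((A)-package, TOOLS∕KNIT∕KNITc, SecondMomentVersion, the typing note), w5 g21
((L7)(L8)), px12 g19 ((β′)), ideator g25∕g26 (rows, R-CUT-χ); this seat composed.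
[cite: Balaban1985Averaging, (10)-(13) p.19; Balaban1987RG1, (0.4) p.253, (0.13) p.254, (2.10) p.267]
-/

set_option autoImplicit false

noncomputable section

namespace Summit.QuantumFields.YangMills.Theorems.FluctuationComparisonRegPrIntLOrganTangentSecondMomentVersionClosed

open MeasureTheory Filter Topology
open scoped ENNReal
open Literature.MathematicalPhysics.QuantumFieldTheory.Balaban1983to89 T3ContinuumYM3Torus T3NestedUnitLaws
  T3UnitLawDensityEML T4Continuum BalabanUVClass T3UnitScaleTilt
open Summit.QuantumFields.YangMills.Theorems.OrganTangentFibreMeanToolsAnyCut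
  (continuous_sfCutRamp sfCutRamp_nonneg plaqSmall_of_sfCutRamp_ne_zero sfCutRamp_pos_of_plaqSmall half_lt_twentyFour_div_twentyFive_and_lt_one)
open Summit.QuantumFields.YangMills.Theorems.OrganTangentSecondMomentVersion (fibreSecondMomentVersion_of_regularSmallFieldDisintegration_ac)

/-- ★★ **THE WINDOW-CONTINUOUS SECOND-MOMENT VERSION EXISTS, EVERY FAMILY, FROM A HEIGHT** — ✓`fibreMeanVersionCan_holds` (row VER∘ v2.6 of
`Lines/organ_tangent.lean`, cutoff inlined) with the integrand squared: in the regime `0 < γ ≤ 1, 0 < b₀, 0 < p₀`, from a height `jW(F, γ, b₀, p₀)` on, in O1 v17.2's frame,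
for EVERY disintegration `σ` of product Haar along `descend`, there is a `window_j`-continuous `v` with `χ_{j+1}·(log ρ_{j+1} − log ρ′_{j+1})²·ρ′_{j+1}` `σ_V`-integrable and
`v V = (∫ χ h² ρ′ dσ_V)∕(∫ χ ρ′ dσ_V)` for `dU_j`-a.e. window `V` (R-VAR's quantifier, LEAD TQ-1).  := ✓(L8) ∘ ✓`fibreSecondMomentVersion_of_regularSmallFieldDisintegration_ac`.
[cite: Balaban1985Averaging, (10)-(13) p.19; Balaban1987RG1, (0.13) p.254 and (2.10) p.267] -/
theorem exists_fibreSecondMomentVersion :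
    ∀ (F : T3Family) (γ b₀ p₀ : ℝ), 0 < γ → γ ≤ 1 → 0 < b₀ → 0 < p₀ → ∃ jV : ℕ, ∀ (j₀ : ℕ) (prm : ℕ → ClassParams) (η : ℕ → ℝ), ∀ (ν : ℕ → (j : ℕ) → MeasureTheory.Measure (GaugeField (F.P j) 0 ↥(Matrix.specialUnitaryGroup (Fin 2) ℂ))), (∀ K, ν K K = T4GenFunBounds.gibbsMeasure (F.P K) ((F.scheme ℰp γ).β K)) → (∀ K j, j < K → ν K j = Measure.map (descend F ℰp j) (ν K (j + 1))) → ∀ (K K' : ℕ), K ≤ K' → ∀ (Ts T : ℕ), Ts < T → T ≤ K → ∀ (μ μ' : ((j : ℕ) → MeasureTheory.Measure (GaugeField (F.P j) 0 ↥(Matrix.specialUnitaryGroup (Fin 2) ℂ)))) (ρ ρ' : ((j : ℕ) → GaugeField (F.P j) 0 ↥(Matrix.specialUnitaryGroup (Fin 2) ℂ) → ℝ)), (∀ j : ℕ, Ts ≤ j → j ≤ T → μ j = ν K j ∧ μ' j = ν K' j) → (∀ j : ℕ, j < Ts → μ j = Measure.map (descend F ℰp j) ((μ (j + 1)).withDensity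 (fun U => ENNReal.ofReal ((∏ p : Plaq (F.P (j + 1)) 0, max 0 (min 1 ((24 / 25 * θBal F.L γ b₀ p₀ (j + 1) - dist1 (GaugeField.plaqHol U p)) / ((24 / 25 - 1 / 2) * θBal F.L γ b₀ p₀ (j + 1)))))))) ∧ μ' j = Measure.map (descend F ℰp j) ((μ' (j + 1)).withDensity (fun U => ENNReal.ofReal ((∏ p : Plaq (F.P (j + 1)) 0, max 0 (min 1 ((24 / 25 * θBal F.L γ b₀ p₀ (j + 1) - dist1 (GaugeField.plaqHol U p)) / ((24 / 25 - 1 / 2) * θBal F.L γ b₀ p₀ (j + 1))))))))) → (∀ j : ℕ, Ts ≤ j → j < T → μ j = Measure.map (descend F ℰp j) (μ (j + 1)) ∧ μ' j = Measure.map (descend F ℰp j) (μ' (j + 1))) → (∀ j : ℕ, j ≤ T → IsFiniteMeasure (μ j) ∧ IsFiniteMeasure (μ' j)) → (∀ j : ℕ, j₀ ≤ j → j ≤ T → ((∀ U, PlaqSmall (θBal F.L γ b₀ p₀ j) U → 0 < ρ j U ∧ 0 < ρ' j U) ∧ μ j = (fieldMeasure _ _ _).withDensity (fun U => ENNReal.ofReal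 (ρ j U)) ∧ μ' j = (fieldMeasure _ _ _).withDensity (fun U => ENNReal.ofReal (ρ' j U)) ∧ (∃ κ : ℝ, MemAtHeight F ℰp j (prm j) (fun U => Real.exp κ * ρ j U)) ∧ (∃ κ : ℝ, MemAtHeight F ℰp j (prm j) (fun U => Real.exp κ * ρ' j U)) ∧ μ j {U | ¬ PlaqSmall (θBal F.L γ b₀ p₀ j) U} ≤ ENNReal.ofReal (η j) ∧ μ' j {U | ¬ PlaqSmall (θBal F.L γ b₀ p₀ j) U} ≤ ENNReal.ofReal (η j) ∧ (ContinuousOn (ρ j) {U | PlaqSmall (θBal F.L γ b₀ p₀ j) U} ∧ ContinuousOn (ρ' j) {U | PlaqSmall (θBal F.L γ b₀ p₀ j) U}))) → ∀ (j : ℕ), jV ≤ j → j₀ ≤ j → j + 1 ≤ T → ∀ (σ : ProbabilityTheory.Kernel (GaugeField (F.P j) 0 ↥(Matrix.specialUnitaryGroup (Fin 2) ℂ)) (GaugeField (F.P (j + 1)) 0 ↥(Matrix.specialUnitaryGroup (Fin 2) ℂ))), ProbabilityTheory.IsMarkovKernel σ → (Measure.map (descend F ℰp j) (fieldMeasure (F.P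 (j + 1)) 0 ↥(Matrix.specialUnitaryGroup (Fin 2) ℂ))).bind ⇑σ = fieldMeasure (F.P (j + 1)) 0 ↥(Matrix.specialUnitaryGroup (Fin 2) ℂ) → (∀ᵐ V ∂(Measure.map (descend F ℰp j) (fieldMeasure (F.P (j + 1)) 0 ↥(Matrix.specialUnitaryGroup (Fin 2) ℂ))), ∀ᵐ U ∂(σ V), descend F ℰp j U = V) → ∃ (v : GaugeField (F.P j) 0 ↥(Matrix.specialUnitaryGroup (Fin 2) ℂ) → ℝ), ContinuousOn v {V | PlaqSmall (θBal F.L γ b₀ p₀ j) V} ∧ (∀ᵐ V ∂(fieldMeasure (F.P j) 0 ↥(Matrix.specialUnitaryGroup (Fin 2) ℂ)), PlaqSmall (θBal F.L γ b₀ p₀ j) V → MeasureTheory.Integrable (fun U => (∏ p : Plaq (F.P (j + 1)) 0, max 0 (min 1 ((24 / 25 * θBal F.L γ b₀ p₀ (j + 1) - dist1 (GaugeField.plaqHol U p)) / ((24 / 25 - 1 / 2) * θBal F.L γ b₀ p₀ (j + 1))))) * (Real.log (ρ (j + 1) U) - Real.log (ρ' (j + 1) U)) ^ 2 * ρ' (j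 + 1) U) (σ V) ∧ v V = (∫ U, (∏ p : Plaq (F.P (j + 1)) 0, max 0 (min 1 ((24 / 25 * θBal F.L γ b₀ p₀ (j + 1) - dist1 (GaugeField.plaqHol U p)) / ((24 / 25 - 1 / 2) * θBal F.L γ b₀ p₀ (j + 1))))) * (Real.log (ρ (j + 1) U) - Real.log (ρ' (j + 1) U)) ^ 2 * ρ' (j + 1) U ∂(σ V)) / (∫ U, (∏ p : Plaq (F.P (j + 1)) 0, max 0 (min 1 ((24 / 25 * θBal F.L γ b₀ p₀ (j + 1) - dist1 (GaugeField.plaqHol U p)) / ((24 / 25 - 1 / 2) * θBal F.L γ b₀ p₀ (j + 1))))) * ρ' (j + 1) U ∂(σ V))) := by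
  intro F γ b₀ p₀ hγ hγ1 hb₀ hp₀
  obtain ⟨jA, hjA⟩ :=
    FluctuationComparisonRegPrIntLOrganTangentAPackageFromHeight.exists_height_regularSmallFieldDisintegration
      F γ b₀ p₀ hγ hγ1 hb₀ hp₀
  refine ⟨jA, ?_⟩
  intro j₀ prm η ν _hνK _hνc K K' _hKK' Ts T _hTsT _hTK μ μ' ρ ρ' _hanch hcut huncut _hfin hwin j hjAj hj hjT σ hσM hbind hfib
  have hθ : 0 < θBal F.L γ b₀ p₀ (j + 1) := T3MinimiserStabilityReduction.θBal_pos F.hL.2.le hγ hγ1 hb₀ p₀ (j + 1)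
  have hc : (1 / 2 : ℝ) < 24 / 25 := half_lt_twentyFour_div_twentyFive_and_lt_one.1
  have hcW : (24 / 25 : ℝ) < 1 := half_lt_twentyFour_div_twentyFive_and_lt_one.2
  obtain ⟨σ₀, lam, hσ₀M, hbind₀, hfib₀, hlam, hA1, hA2, hA3⟩ := hjA j hjAj
  have hw1 := hwin (j + 1) (by omega) hjT
  have hw0 := hwin j hj (by omega)
  -- measurability of `ρ j` from membership modulo a constant (R-n4)
  have hρjm : Measurable (ρ j) := by
    obtain ⟨κ, hκ⟩ := hw0.2.2.2.1
    have h1 : Measurable (fun U => Real.exp κ * ρ j U) := hκ.measurable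
    have h2 : ρ j = fun U => (Real.exp κ)⁻¹ * (Real.exp κ * ρ j U) := by
      funext U; rw [← mul_assoc, inv_mul_cancel₀ (Real.exp_pos κ).ne', one_mul]
    rw [h2]; exact h1.const_mul _
  -- the `≪`-form transfer measure of the second-moment knit, by regime
  by_cases hjTs : j < Ts
  · -- CUT step (smooth, v2.6 ramp): `μ j = descend_* ((μ (j+1)).withDensity χ_{j+1})`
    have hcut' := (hcut j hjTs).1
    have hmY : ((fieldMeasure (F.P (j + 1)) 0 ↥(Matrix.specialUnitaryGroup (Fin 2) ℂ)).withDensity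
          (fun U => ENNReal.ofReal (ρ (j + 1) U))).withDensity
          (fun U => ENNReal.ofReal (∏ p : Plaq (F.P (j + 1)) 0, max 0 (min 1 ((24 / 25 * θBal F.L γ b₀ p₀ (j + 1) - dist1 (GaugeField.plaqHol U p)) / ((24 / 25 - 1 / 2) * θBal F.L γ b₀ p₀ (j + 1)))))) ≪
        fieldMeasure (F.P (j + 1)) 0 ↥(Matrix.specialUnitaryGroup (Fin 2) ℂ) :=
      (withDensity_absolutelyContinuous _ _).trans (withDensity_absolutelyContinuous _ _)
    have hdens : (((fieldMeasure (F.P (j + 1)) 0 ↥(Matrix.specialUnitaryGroup (Fin 2) ℂ)).withDensity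
          (fun U => ENNReal.ofReal (ρ (j + 1) U))).withDensity
          (fun U => ENNReal.ofReal (∏ p : Plaq (F.P (j + 1)) 0, max 0 (min 1 ((24 / 25 * θBal F.L γ b₀ p₀ (j + 1) - dist1 (GaugeField.plaqHol U p)) / ((24 / 25 - 1 / 2) * θBal F.L γ b₀ p₀ (j + 1))))))).map (descend F ℰp j) =
        (fieldMeasure (F.P j) 0 ↥(Matrix.specialUnitaryGroup (Fin 2) ℂ)).withDensity (fun V => ENNReal.ofReal (ρ j V)) := by
      rw [← hw1.2.1, ← hcut', hw0.2.1]
    exact fibreSecondMomentVersion_of_regularSmallFieldDisintegration_ac F γ b₀ p₀ j hθ (24 / 25) hcW (ρ (j + 1)) (ρ' (j + 1)) (ρ j)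
      hw1.1 hw1.2.2.2.2.2.2.2.1 hw1.2.2.2.2.2.2.2.2 hρjm (fun V hV => (hw0.1 V hV).1) _ hmY hdens
      σ hσM hbind hfib (fun U => ∏ p : Plaq (F.P (j + 1)) 0, max 0 (min 1 ((24 / 25 * θBal F.L γ b₀ p₀ (j + 1) - dist1 (GaugeField.plaqHol U p)) / ((24 / 25 - 1 / 2) * θBal F.L γ b₀ p₀ (j + 1))))) (continuous_sfCutRamp _ _ _) (sfCutRamp_nonneg _ _ _)
      (plaqSmall_of_sfCutRamp_ne_zero hc hθ) (sfCutRamp_pos_of_plaqSmall hc hθ)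
      σ₀ hσ₀M hbind₀ hfib₀ lam hlam hA1 hA2 hA3
  · -- UNCUT step `Ts ≤ j < T`: `μ j = descend_* μ (j+1)`
    have hcut' := (huncut j (not_lt.mp hjTs) (by omega)).1
    have hmY : (fieldMeasure (F.P (j + 1)) 0 ↥(Matrix.specialUnitaryGroup (Fin 2) ℂ)).withDensity
          (fun U => ENNReal.ofReal (ρ (j + 1) U)) ≪
        fieldMeasure (F.P (j + 1)) 0 ↥(Matrix.specialUnitaryGroup (Fin 2) ℂ) := withDensity_absolutelyContinuous _ _
    have hdens : ((fieldMeasure (F.P (j + 1)) 0 ↥(Matrix.specialUnitaryGroup (Fin 2) ℂ)).withDensity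
          (fun U => ENNReal.ofReal (ρ (j + 1) U))).map (descend F ℰp j) =
        (fieldMeasure (F.P j) 0 ↥(Matrix.specialUnitaryGroup (Fin 2) ℂ)).withDensity (fun V => ENNReal.ofReal (ρ j V)) := by
      rw [← hw1.2.1, ← hcut', hw0.2.1]
    exact fibreSecondMomentVersion_of_regularSmallFieldDisintegration_ac F γ b₀ p₀ j hθ (24 / 25) hcW (ρ (j + 1)) (ρ' (j + 1)) (ρ j)
      hw1.1 hw1.2.2.2.2.2.2.2.1 hw1.2.2.2.2.2.2.2.2 hρjm (fun V hV => (hw0.1 V hV).1) _ hmY hdens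
      σ hσM hbind hfib (fun U => ∏ p : Plaq (F.P (j + 1)) 0, max 0 (min 1 ((24 / 25 * θBal F.L γ b₀ p₀ (j + 1) - dist1 (GaugeField.plaqHol U p)) / ((24 / 25 - 1 / 2) * θBal F.L γ b₀ p₀ (j + 1))))) (continuous_sfCutRamp _ _ _) (sfCutRamp_nonneg _ _ _)
      (plaqSmall_of_sfCutRamp_ne_zero hc hθ) (sfCutRamp_pos_of_plaqSmall hc hθ)
      σ₀ hσ₀M hbind₀ hfib₀ lam hlam hA1 hA2 hA3

end Summit.QuantumFields.YangMills.Theorems.FluctuationComparisonRegPrIntLOrganTangentSecondMomentVersionClosed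

end
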